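import Mathlib
import Summits.SmoothPoincare4.Statement
import Summits.SmoothPoincare4.SmoothPoincare4.Theses.RootDecompY
import Literature.Topology.FourManifolds.ConnectedSum
import Literature.Topology.FourManifolds.ComplexProjectiveSpace

/-!
# Line «fibre-dual» for the crux `RootDecompY.TwistedDescent` (stmt-SmoothPoincare4-31189)

Writer copy (decomp-sp4-writer-1 g4): byte-identical to the lens file HOME/decomp-sp4-lens-6/v11/lines/FibreDual_TwistedDescent.lean except that the two stubs are
RENAMED `stub_arrangement → stub_fibreArrangement`, `stub_exchange → stub_fibreExchange`, because the crux #31189 already carries the registered line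
`Lines/odd_dual.lean` whose stubs are named `stub_arrangement` / `stub_exchange` (stub-keyed units `sidea-<stub>-k` / `scrit-<stub>` must not collide).

Skeleton (CRUX-PLAN shape): two registered stubs — the ARRANGEMENT stub `stub_fibreArrangement` (NEW, load-bearing:
`= DecompSp4.Lens6.FibreLightBulb11.FibreDualArrangement` verbatim) and the EXCHANGE stub `stub_fibreExchange`
(cited: Gabai2020 Thm 1.2 light-bulb isotopy in `ℂℙ² # ℂℙ²bar` with the FIBRE as common transverse sphere + Cerf;
`= FibreDualExchange` verbatim; paper proof `pub/decomp-sp4/decomp-sp4-lens-6/v11/NODE.md` §2) — and the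
kernel-checked composition `TwistedDescent_of : RootDecompY.TwistedDescent` which USES both stubs (sorries = stubs
= 2, both reachable; no orphan stub, no conditional composition).  One-line `Prop`s over tree declarations.
-/

noncomputable section

set_option linter.dupNamespace false

open scoped Manifold ContDiff

namespace Summit.SmoothPoincare4.SmoothPoincare4.Cruxes.TwistedDescent.FibreDual

/-- stub (load-bearing, NEW): FIBRE–DUAL ARRANGEMENT — the hypothesis of `TwistedDescent` VERBATIM implies the
fibre normal form `NF_F(M)` (some `φ : P₂ ≅ Y = ℂℙ² # ℂℙ²` for which the STANDARD FIBRE `G` — a line through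
the disc centre in each summand, closing up across the neck; required to be a light bulb `G = g(S² × 0)`,
`g : S² × ℝ² ↪ Y` open — meets the image `S` of a line of the last summand and standard lines `A`, `B` of the two
`Y`-summands once each, transversally). -/
theorem stub_fibreArrangement :
    open scoped ContDiff in ∀ (M : Type) [TopologicalSpace M] [T2Space M] [SecondCountableTopology M] [ChartedSpace (EuclideanSpace ℝ (Fin 4)) M] [IsManifold (𝓡 4) ∞ M], ContinuousMap.HomotopyEquiv M (Metric.sphere (0 : EuclideanSpace ℝ (Fin 5)) 1) → (∃ (P₁ P₂ R : Type) (_ : TopologicalSpace P₁) (_ : T2Space P₁) (_ : SecondCountableTopology P₁) (_ : ChartedSpace (EuclideanSpace ℝ (Fin 4)) P₁) (_ : IsManifold (𝓡 4) ∞ P₁) (_ : TopologicalSpace P₂) (_ : T2Space P₂) (_ : SecondCountableTopology P₂) (_ : ChartedSpace (EuclideanSpace ℝ (Fin 4)) P₂) (_ : IsManifold (𝓡 4) ∞ P₂) (_ : TopologicalSpace R) (_ : T2Space R) (_ : SecondCountableTopology R) (_ : ChartedSpace (EuclideanSpace ℝ (Fin 4)) R) (_ : IsManifold (𝓡 4)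 ∞ R), Literature.Topology.FourManifolds.IsConnectedSum (𝓡 4) (𝓡 4) (𝓡 4) M Literature.Topology.FourManifolds.ComplexProjectivePlane P₁ ∧ Literature.Topology.FourManifolds.IsConnectedSum (𝓡 4) (𝓡 4) (𝓡 4) P₁ Literature.Topology.FourManifolds.ComplexProjectivePlane P₂ ∧ (∃ (c : Literature.Topology.FourManifolds.SmoothOrientation (𝓡 4) Literature.Topology.FourManifolds.ComplexProjectivePlane) (oR : Literature.Topology.FourManifolds.SmoothOrientation (𝓡 4) R), Literature.Topology.FourManifolds.IsOrientedConnectedSum c (-c) oR) ∧ Nonempty (P₂ ≃ₘ⟮𝓡 4, 𝓡 4⟯ R)) → ∃ (P₁ P₂ Y : Type) (_ : TopologicalSpace P₁) (_ : T2Space P₁) (_ : SecondCountableTopology P₁) (_ : ChartedSpace (EuclideanSpace ℝ (Fin 4)) P₁) (_ : IsManifold (𝓡 4) ∞ P₁) (_ : TopologicalSpace P₂) (_ : T2Space P₂) (_ : SecondCountableTopology P₂) (_ : ChartedSpace (EuclideanSpace ℝ (Fin 4)) P₂) (_ : IsManifold (𝓡 4) ∞ P₂) (_ : TopologicalSpace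 Y) (_ : T2Space Y) (_ : SecondCountableTopology Y) (_ : ChartedSpace (EuclideanSpace ℝ (Fin 4)) Y) (_ : IsManifold (𝓡 4) ∞ Y), Literature.Topology.FourManifolds.IsConnectedSum (𝓡 4) (𝓡 4) (𝓡 4) M Literature.Topology.FourManifolds.ComplexProjectivePlane P₁ ∧ ∃ (i₁ : EuclideanSpace ℝ (Fin 4) → P₁) (i₂ : EuclideanSpace ℝ (Fin 4) → Literature.Topology.FourManifolds.ComplexProjectivePlane) (jA : ↥(Literature.Topology.FourManifolds.puncture i₁) → P₂) (jB : ↥(Literature.Topology.FourManifolds.puncture i₂) → P₂) (k₁ : EuclideanSpace ℝ (Fin 4) → Literature.Topology.FourManifolds.ComplexProjectivePlane) (k₂ : EuclideanSpace ℝ (Fin 4) → Literature.Topology.FourManifolds.ComplexProjectivePlane) (lA : ↥(Literature.Topology.FourManifolds.puncture k₁) → Y) (lB : ↥(Literature.Topology.FourManifolds.puncture k₂) → Y) (φ : P₂ ≃ₘ⟮𝓡 4, 𝓡 4⟯ Y) (g : ↥(Metric.sphere (0 : EuclideanSpace ℝ (Fin 3)) 1) × EuclideanSpace ℝ (Fin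 2) → Y) (a₁ a₂ a₃ b₁ b₂ : Fin 3 → ℂ), (Manifold.IsSmoothEmbedding 𝓘(ℝ, EuclideanSpace ℝ (Fin 4)) (𝓡 4) ∞ i₁ ∧ Manifold.IsSmoothEmbedding 𝓘(ℝ, EuclideanSpace ℝ (Fin 4)) (𝓡 4) ∞ i₂ ∧ Manifold.IsSmoothEmbedding (𝓡 4) (𝓡 4) ∞ jA ∧ IsOpen (Set.range jA) ∧ Manifold.IsSmoothEmbedding (𝓡 4) (𝓡 4) ∞ jB ∧ IsOpen (Set.range jB) ∧ Set.range jA ∪ Set.range jB = Set.univ ∧ (∀ a b, jA a = jB b ↔ Literature.Topology.FourManifolds.connectedSumRel i₁ i₂ a b)) ∧ (Manifold.IsSmoothEmbedding 𝓘(ℝ, EuclideanSpace ℝ (Fin 4)) (𝓡 4) ∞ k₁ ∧ Manifold.IsSmoothEmbedding 𝓘(ℝ, EuclideanSpace ℝ (Fin 4)) (𝓡 4) ∞ k₂ ∧ Manifold.IsSmoothEmbedding (𝓡 4) (𝓡 4) ∞ lA ∧ IsOpen (Set.range lA) ∧ Manifold.IsSmoothEmbedding (𝓡 4) (𝓡 4)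 ∞ lB ∧ IsOpen (Set.range lB) ∧ Set.range lA ∪ Set.range lB = Set.univ ∧ (∀ a b, lA a = lB b ↔ Literature.Topology.FourManifolds.connectedSumRel k₁ k₂ a b)) ∧ (Manifold.IsSmoothEmbedding ((𝓡 2).prod (𝓡 2)) (𝓡 4) ∞ g ∧ IsOpen (Set.range g)) ∧ a₁ ≠ 0 ∧ a₂ ≠ 0 ∧ a₃ ≠ 0 ∧ i₂ 0 ∉ {p : Literature.Topology.FourManifolds.ComplexProjectivePlane | ∃ v : {v : Fin 3 → ℂ // v ≠ 0}, Literature.Topology.FourManifolds.ComplexProjectiveSpace.mk v = p ∧ ∑ j, a₁ j * v.1 j = 0} ∧ k₂ 0 ∉ {p : Literature.Topology.FourManifolds.ComplexProjectivePlane | ∃ v : {v : Fin 3 → ℂ // v ≠ 0}, Literature.Topology.FourManifolds.ComplexProjectiveSpace.mk v = p ∧ ∑ j, a₂ j * v.1 j = 0} ∧ k₁ 0 ∉ {p : Literature.Topology.FourManifolds.ComplexProjectivePlane | ∃ v : {v : Fin 3 → ℂ // v ≠ 0}, Literature.Topology.FourManifolds.ComplexProjectiveSpace.mk v = p ∧ ∑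 j, a₃ j * v.1 j = 0} ∧ b₁ ≠ 0 ∧ b₂ ≠ 0 ∧ k₁ 0 ∈ {p : Literature.Topology.FourManifolds.ComplexProjectivePlane | ∃ v : {v : Fin 3 → ℂ // v ≠ 0}, Literature.Topology.FourManifolds.ComplexProjectiveSpace.mk v = p ∧ ∑ j, b₁ j * v.1 j = 0} ∧ k₂ 0 ∈ {p : Literature.Topology.FourManifolds.ComplexProjectivePlane | ∃ v : {v : Fin 3 → ℂ // v ≠ 0}, Literature.Topology.FourManifolds.ComplexProjectiveSpace.mk v = p ∧ ∑ j, b₂ j * v.1 j = 0} ∧ ∃ (S A B G : Set Y), (S = (fun x => φ x) '' (jB '' {b : ↥(Literature.Topology.FourManifolds.puncture i₂) | (b : Literature.Topology.FourManifolds.ComplexProjectivePlane) ∈ {p : Literature.Topology.FourManifolds.ComplexProjectivePlane | ∃ v : {v : Fin 3 → ℂ // v ≠ 0}, Literature.Topology.FourManifolds.ComplexProjectiveSpace.mk v = p ∧ ∑ j, a₁ j * v.1 j = 0}}) ∧ A = lB '' {b : ↥(Literature.Topology.FourManifolds.puncture k₂) | (b : Literature.Topology.FourManifolds.ComplexProjectivePlane)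 ∈ {p : Literature.Topology.FourManifolds.ComplexProjectivePlane | ∃ v : {v : Fin 3 → ℂ // v ≠ 0}, Literature.Topology.FourManifolds.ComplexProjectiveSpace.mk v = p ∧ ∑ j, a₂ j * v.1 j = 0}} ∧ B = lA '' {b : ↥(Literature.Topology.FourManifolds.puncture k₁) | (b : Literature.Topology.FourManifolds.ComplexProjectivePlane) ∈ {p : Literature.Topology.FourManifolds.ComplexProjectivePlane | ∃ v : {v : Fin 3 → ℂ // v ≠ 0}, Literature.Topology.FourManifolds.ComplexProjectiveSpace.mk v = p ∧ ∑ j, a₃ j * v.1 j = 0}} ∧ G = g '' {q : ↥(Metric.sphere (0 : EuclideanSpace ℝ (Fin 3)) 1) × EuclideanSpace ℝ (Fin 2) | q.2 = 0} ∧ G = lA '' {b : ↥(Literature.Topology.FourManifolds.puncture k₁) | (b : Literature.Topology.FourManifolds.ComplexProjectivePlane) ∈ {p : Literature.Topology.FourManifolds.ComplexProjectivePlane | ∃ v : {v : Fin 3 → ℂ // v ≠ 0}, Literature.Topology.FourManifolds.ComplexProjectiveSpace.mk v = p ∧ ∑ j, b₁ j * v.1 j = 0}} ∪ lB '' {b :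 ↥(Literature.Topology.FourManifolds.puncture k₂) | (b : Literature.Topology.FourManifolds.ComplexProjectivePlane) ∈ {p : Literature.Topology.FourManifolds.ComplexProjectivePlane | ∃ v : {v : Fin 3 → ℂ // v ≠ 0}, Literature.Topology.FourManifolds.ComplexProjectiveSpace.mk v = p ∧ ∑ j, b₂ j * v.1 j = 0}} ∧ (∃ p : Y, G ∩ S = {p} ∧ ∃ e : OpenPartialHomeomorph Y (EuclideanSpace ℝ (Fin 4)), e ∈ IsManifold.maximalAtlas (𝓡 4) ∞ Y ∧ p ∈ e.source ∧ ∀ q ∈ e.source, (q ∈ G ↔ (e q) 1 = (e p) 1 ∧ (e q) 3 = (e p) 3) ∧ (q ∈ S ↔ (e q) 0 = (e p) 0 ∧ (e q) 2 = (e p) 2)) ∧ (∃ p : Y, G ∩ A = {p} ∧ ∃ e : OpenPartialHomeomorph Y (EuclideanSpace ℝ (Fin 4)), e ∈ IsManifold.maximalAtlas (𝓡 4) ∞ Y ∧ p ∈ e.source ∧ ∀ q ∈ e.source, (q ∈ G ↔ (e q) 1 = (e p) 1 ∧ (e q) 3 = (e p) 3) ∧ (q ∈ A ↔ (e q) 0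 = (e p) 0 ∧ (e q) 2 = (e p) 2)) ∧ (∃ p : Y, G ∩ B = {p} ∧ ∃ e : OpenPartialHomeomorph Y (EuclideanSpace ℝ (Fin 4)), e ∈ IsManifold.maximalAtlas (𝓡 4) ∞ Y ∧ p ∈ e.source ∧ ∀ q ∈ e.source, (q ∈ G ↔ (e q) 1 = (e p) 1 ∧ (e q) 3 = (e p) 3) ∧ (q ∈ B ↔ (e q) 0 = (e p) 0 ∧ (e q) 2 = (e p) 2))) := by
  sorry

/-- stub (cited; COSTUME modulo the exchange lemma): FIBRE–DUAL EXCHANGE — `NF_F(M)` implies `M # ℂℙ² ≅ ℂℙ²`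
(Gabai2020 Thm 1.2: `S` is isotopic to the homologous standard line since both have the common transverse sphere
`G`; complements + Cerf). -/
theorem stub_fibreExchange :
    open scoped ContDiff in ∀ (M : Type) [TopologicalSpace M] [T2Space M] [SecondCountableTopology M] [ChartedSpace (EuclideanSpace ℝ (Fin 4)) M] [IsManifold (𝓡 4) ∞ M], ContinuousMap.HomotopyEquiv M (Metric.sphere (0 : EuclideanSpace ℝ (Fin 5)) 1) → (∃ (P₁ P₂ Y : Type) (_ : TopologicalSpace P₁) (_ : T2Space P₁) (_ : SecondCountableTopology P₁) (_ : ChartedSpace (EuclideanSpace ℝ (Fin 4)) P₁) (_ : IsManifold (𝓡 4) ∞ P₁) (_ : TopologicalSpace P₂) (_ : T2Space P₂) (_ : SecondCountableTopology P₂) (_ : ChartedSpace (EuclideanSpace ℝ (Fin 4)) P₂) (_ : IsManifold (𝓡 4) ∞ P₂) (_ : TopologicalSpace Y) (_ : T2Space Y) (_ : SecondCountableTopology Y) (_ : ChartedSpace (EuclideanSpace ℝ (Fin 4)) Y) (_ : IsManifold (𝓡 4) ∞ Y), Literature.Topology.FourManifolds.IsConnectedSum (𝓡 4) (𝓡 4)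 (𝓡 4) M Literature.Topology.FourManifolds.ComplexProjectivePlane P₁ ∧ ∃ (i₁ : EuclideanSpace ℝ (Fin 4) → P₁) (i₂ : EuclideanSpace ℝ (Fin 4) → Literature.Topology.FourManifolds.ComplexProjectivePlane) (jA : ↥(Literature.Topology.FourManifolds.puncture i₁) → P₂) (jB : ↥(Literature.Topology.FourManifolds.puncture i₂) → P₂) (k₁ : EuclideanSpace ℝ (Fin 4) → Literature.Topology.FourManifolds.ComplexProjectivePlane) (k₂ : EuclideanSpace ℝ (Fin 4) → Literature.Topology.FourManifolds.ComplexProjectivePlane) (lA : ↥(Literature.Topology.FourManifolds.puncture k₁) → Y) (lB : ↥(Literature.Topology.FourManifolds.puncture k₂) → Y) (φ : P₂ ≃ₘ⟮𝓡 4, 𝓡 4⟯ Y) (g : ↥(Metric.sphere (0 : EuclideanSpace ℝ (Fin 3)) 1) × EuclideanSpace ℝ (Fin 2) → Y) (a₁ a₂ a₃ b₁ b₂ : Fin 3 → ℂ), (Manifold.IsSmoothEmbedding 𝓘(ℝ, EuclideanSpace ℝ (Fin 4)) (𝓡 4) ∞ i₁ ∧ Manifold.IsSmoothEmbedding 𝓘(ℝ,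 EuclideanSpace ℝ (Fin 4)) (𝓡 4) ∞ i₂ ∧ Manifold.IsSmoothEmbedding (𝓡 4) (𝓡 4) ∞ jA ∧ IsOpen (Set.range jA) ∧ Manifold.IsSmoothEmbedding (𝓡 4) (𝓡 4) ∞ jB ∧ IsOpen (Set.range jB) ∧ Set.range jA ∪ Set.range jB = Set.univ ∧ (∀ a b, jA a = jB b ↔ Literature.Topology.FourManifolds.connectedSumRel i₁ i₂ a b)) ∧ (Manifold.IsSmoothEmbedding 𝓘(ℝ, EuclideanSpace ℝ (Fin 4)) (𝓡 4) ∞ k₁ ∧ Manifold.IsSmoothEmbedding 𝓘(ℝ, EuclideanSpace ℝ (Fin 4)) (𝓡 4) ∞ k₂ ∧ Manifold.IsSmoothEmbedding (𝓡 4) (𝓡 4) ∞ lA ∧ IsOpen (Set.range lA) ∧ Manifold.IsSmoothEmbedding (𝓡 4) (𝓡 4) ∞ lB ∧ IsOpen (Set.range lB) ∧ Set.range lA ∪ Set.range lB = Set.univ ∧ (∀ a b, lA a = lB b ↔ Literature.Topology.FourManifolds.connectedSumRel k₁ k₂ a b)) ∧ (Manifold.IsSmoothEmbedding ((𝓡 2).prod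 (𝓡 2)) (𝓡 4) ∞ g ∧ IsOpen (Set.range g)) ∧ a₁ ≠ 0 ∧ a₂ ≠ 0 ∧ a₃ ≠ 0 ∧ i₂ 0 ∉ {p : Literature.Topology.FourManifolds.ComplexProjectivePlane | ∃ v : {v : Fin 3 → ℂ // v ≠ 0}, Literature.Topology.FourManifolds.ComplexProjectiveSpace.mk v = p ∧ ∑ j, a₁ j * v.1 j = 0} ∧ k₂ 0 ∉ {p : Literature.Topology.FourManifolds.ComplexProjectivePlane | ∃ v : {v : Fin 3 → ℂ // v ≠ 0}, Literature.Topology.FourManifolds.ComplexProjectiveSpace.mk v = p ∧ ∑ j, a₂ j * v.1 j = 0} ∧ k₁ 0 ∉ {p : Literature.Topology.FourManifolds.ComplexProjectivePlane | ∃ v : {v : Fin 3 → ℂ // v ≠ 0}, Literature.Topology.FourManifolds.ComplexProjectiveSpace.mk v = p ∧ ∑ j, a₃ j * v.1 j = 0} ∧ b₁ ≠ 0 ∧ b₂ ≠ 0 ∧ k₁ 0 ∈ {p : Literature.Topology.FourManifolds.ComplexProjectivePlane | ∃ v : {v : Fin 3 → ℂ // v ≠ 0}, Literature.Topology.FourManifolds.ComplexProjectiveSpace.mk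 v = p ∧ ∑ j, b₁ j * v.1 j = 0} ∧ k₂ 0 ∈ {p : Literature.Topology.FourManifolds.ComplexProjectivePlane | ∃ v : {v : Fin 3 → ℂ // v ≠ 0}, Literature.Topology.FourManifolds.ComplexProjectiveSpace.mk v = p ∧ ∑ j, b₂ j * v.1 j = 0} ∧ ∃ (S A B G : Set Y), (S = (fun x => φ x) '' (jB '' {b : ↥(Literature.Topology.FourManifolds.puncture i₂) | (b : Literature.Topology.FourManifolds.ComplexProjectivePlane) ∈ {p : Literature.Topology.FourManifolds.ComplexProjectivePlane | ∃ v : {v : Fin 3 → ℂ // v ≠ 0}, Literature.Topology.FourManifolds.ComplexProjectiveSpace.mk v = p ∧ ∑ j, a₁ j * v.1 j = 0}}) ∧ A = lB '' {b : ↥(Literature.Topology.FourManifolds.puncture k₂) | (b : Literature.Topology.FourManifolds.ComplexProjectivePlane) ∈ {p : Literature.Topology.FourManifolds.ComplexProjectivePlane | ∃ v : {v : Fin 3 → ℂ // v ≠ 0}, Literature.Topology.FourManifolds.ComplexProjectiveSpace.mk v = p ∧ ∑ j, a₂ j * v.1 j = 0}} ∧ B = lA '' {b : ↥(Literature.Topology.FourManifolds.puncture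 k₁) | (b : Literature.Topology.FourManifolds.ComplexProjectivePlane) ∈ {p : Literature.Topology.FourManifolds.ComplexProjectivePlane | ∃ v : {v : Fin 3 → ℂ // v ≠ 0}, Literature.Topology.FourManifolds.ComplexProjectiveSpace.mk v = p ∧ ∑ j, a₃ j * v.1 j = 0}} ∧ G = g '' {q : ↥(Metric.sphere (0 : EuclideanSpace ℝ (Fin 3)) 1) × EuclideanSpace ℝ (Fin 2) | q.2 = 0} ∧ G = lA '' {b : ↥(Literature.Topology.FourManifolds.puncture k₁) | (b : Literature.Topology.FourManifolds.ComplexProjectivePlane) ∈ {p : Literature.Topology.FourManifolds.ComplexProjectivePlane | ∃ v : {v : Fin 3 → ℂ // v ≠ 0}, Literature.Topology.FourManifolds.ComplexProjectiveSpace.mk v = p ∧ ∑ j, b₁ j * v.1 j = 0}} ∪ lB '' {b : ↥(Literature.Topology.FourManifolds.puncture k₂) | (b : Literature.Topology.FourManifolds.ComplexProjectivePlane) ∈ {p : Literature.Topology.FourManifolds.ComplexProjectivePlane | ∃ v : {v : Fin 3 → ℂ // v ≠ 0}, Literature.Topology.FourManifolds.ComplexProjectiveSpace.mk v = p ∧ ∑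 j, b₂ j * v.1 j = 0}} ∧ (∃ p : Y, G ∩ S = {p} ∧ ∃ e : OpenPartialHomeomorph Y (EuclideanSpace ℝ (Fin 4)), e ∈ IsManifold.maximalAtlas (𝓡 4) ∞ Y ∧ p ∈ e.source ∧ ∀ q ∈ e.source, (q ∈ G ↔ (e q) 1 = (e p) 1 ∧ (e q) 3 = (e p) 3) ∧ (q ∈ S ↔ (e q) 0 = (e p) 0 ∧ (e q) 2 = (e p) 2)) ∧ (∃ p : Y, G ∩ A = {p} ∧ ∃ e : OpenPartialHomeomorph Y (EuclideanSpace ℝ (Fin 4)), e ∈ IsManifold.maximalAtlas (𝓡 4) ∞ Y ∧ p ∈ e.source ∧ ∀ q ∈ e.source, (q ∈ G ↔ (e q) 1 = (e p) 1 ∧ (e q) 3 = (e p) 3) ∧ (q ∈ A ↔ (e q) 0 = (e p) 0 ∧ (e q) 2 = (e p) 2)) ∧ (∃ p : Y, G ∩ B = {p} ∧ ∃ e : OpenPartialHomeomorph Y (EuclideanSpace ℝ (Fin 4)), e ∈ IsManifold.maximalAtlas (𝓡 4) ∞ Y ∧ p ∈ e.source ∧ ∀ q ∈ e.source, (q ∈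 G ↔ (e q) 1 = (e p) 1 ∧ (e q) 3 = (e p) 3) ∧ (q ∈ B ↔ (e q) 0 = (e p) 0 ∧ (e q) 2 = (e p) 2)))) → ∃ (P : Type) (_ : TopologicalSpace P) (_ : T2Space P) (_ : SecondCountableTopology P) (_ : ChartedSpace (EuclideanSpace ℝ (Fin 4)) P) (_ : IsManifold (𝓡 4) ∞ P), Literature.Topology.FourManifolds.IsConnectedSum (𝓡 4) (𝓡 4) (𝓡 4) M Literature.Topology.FourManifolds.ComplexProjectivePlane P ∧ Nonempty (P ≃ₘ⟮𝓡 4, 𝓡 4⟯ Literature.Topology.FourManifolds.ComplexProjectivePlane) := by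
  sorry

/-- The line concludes the crux BY NAME and USES the registered stubs:
`RootDecompY.TwistedDescent` from `stub_fibreArrangement` then `stub_fibreExchange`. -/
theorem TwistedDescent_of :
    Summit.SmoothPoincare4.SmoothPoincare4.Theses.RootDecompY.TwistedDescent := by
  intro M _ _ _ _ _ e hdata
  exact stub_fibreExchange M e (stub_fibreArrangement M e hdata)

end Summit.SmoothPoincare4.SmoothPoincare4.Cruxes.TwistedDescent.FibreDual
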